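import Mathlib
import Literature.Geometry.DiscreteGeometry.KissingPatterns

/-!
# FrustratedLawDichotomy · crux `AperiodicFrustratedLawGap` (stmt-AtomisticToContinuum-27623) — THE TWISTED DOZEN:
# `KR_shape12` (twelve-point kissing rigidity at 2 %, census line I-RIG′ / TAG 146) IS FALSE (decomp-a2c, prover hand 2, gen 8)

`KR_shape12` (hypothesis `h12` of `FrustratedLawDichotomyKissingRigidityShapeTwelve.krShape_of_krShape12`, the census statement the
concordance `ChargedEnergyGap ∧ KR_shape12 ⟹ FDG` rests on) asserts: twelve points `q` with `d ≤ dist (q a) p ≤ 1.01 d`, pairwise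
`≥ (100/101) d`, carrying a symmetric irreflexive contact relation with contacts `≤ 1.0201 d`, non-contacts `> d` and EXACTLY FOUR contacts
at every point, lie within `η d`, `η < 1/20`, of a rotated fcc or hcp kissing pattern.

**It is false.**  Witness (integer model, scale `d = √61`): the pyritohedral «twisted dozen»
`(0, ±5, ±6), (±6, 0, ±5), (±5, ±6, 0)` about `p = 0` — the cuboctahedron `(0, ±1, ±1), …` pushed along the jitterbug flex
`(0, ±1, ±t), (±t, 0, ±1), (±1, ±t, 0)` to `t = 6/5`.  All twelve points have squared norm `61`; each has exactly four others at squared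
distance `62 ≤ (1.0201)²·61` (its contacts) and the remaining seven at squared distance `∈ {100, 144, 182, 244}` (`> 61`): every
hypothesis of `KR_shape12` holds (the contact graph IS the cuboctahedron graph).  But both kissing patterns contain a pair at distance
EXACTLY `√2` (a square diagonal: `(1,1,0)/√2, (−1,1,0)/√2`, resp. `(3,3,0)/√18, (−3,3,0)/√18`), and an `η d`-fit with `η < 1/20` would put
the corresponding pair of the dozen at distance within `d/10` of `√2·d = √122 ≈ 11.05`, i.e. at squared distance in `(105.3, 139.9)` —
the dozen has no squared distance strictly between `100` and `144`.  (Along the flex the contact lengths change only to SECOND order,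
`e/ρ − 1 ≈ 0.2 (t − 1)²`, while the points move to first order, `≈ 0.45 (t − 1)·ρ`: contact data at tolerance `ε` pins a kissing dozen
only to `O(√ε)`; `ε = 2 %` allows displacements `≈ 0.13 ρ > ρ/20`.)

Consequences for the cell's map: the edge `14231 ∧ KR_shape12 ⟹ FDG` (p816717) has a refuted second hypothesis; TAG 146 «KR-SHAPE»
(kernel certificate FOR `KR_shape12`) is moot; a true kissing-rigidity dictionary needs contact tolerance `≲ (η)² ≈ 1/400` or second-shell
data.  The bond-graph form `KR` (charge-free(1/100) ⟹ robustly good) falls to the same dozen plus its centre (separate file).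

* `fit_pair_bound` : the metric core — two `r`-fits transport a pattern distance up to `2r`.
* `twisted_dozen_no_sqrt_two` : no fit of a `√2`-pair of a unit pattern onto two points at squared distance `≤ 100` or `≥ 144` at scale `√61`
  with tolerance `< √61/20`.
* `not_krShape12` : `¬ KR_shape12` (statement of the tree VERBATIM, negated).  `[folklore]`; no definitions, no `sorry`.
-/

noncomputable section

namespace Summit.AtomisticToContinuum.Crystallization.Theorems.FrustratedLawDichotomyTwistedDozen

open Literature.Geometry.DiscreteGeometry

/-- **Two fits transport a distance.**  If `‖x − c•A u‖ ≤ r` and `‖y − c•A v‖ ≤ r` for a linear isometry `A`, then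
`c‖u − v‖ − 2r ≤ ‖x − y‖ ≤ c‖u − v‖ + 2r` (`c ≥ 0`). [folklore] -/
theorem fit_pair_bound {x y u v : EuclideanSpace ℝ (Fin 3)} {c r : ℝ} (hc : 0 ≤ c)
    (A : EuclideanSpace ℝ (Fin 3) →ₗᵢ[ℝ] EuclideanSpace ℝ (Fin 3))
    (hx : ‖x - c • A u‖ ≤ r) (hy : ‖y - c • A v‖ ≤ r) :
    c * ‖u - v‖ - 2 * r ≤ ‖x - y‖ ∧ ‖x - y‖ ≤ c * ‖u - v‖ + 2 * r := by
  have hAB : ‖c • A u - c • A v‖ = c * ‖u - v‖ := by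
    rw [← smul_sub, norm_smul, Real.norm_of_nonneg hc, ← map_sub, LinearIsometry.norm_map]
  have htri : ‖(x - y) - (c • A u - c • A v)‖ ≤ 2 * r := by
    have h1 : (x - y) - (c • A u - c • A v) = (x - c • A u) - (y - c • A v) := by abel
    rw [h1]
    exact (norm_sub_le _ _).trans (by linarith)
  have habs := abs_norm_sub_norm_le (x - y) (c • A u - c • A v)
  rw [hAB] at habs
  constructor
  · linarith [(abs_le.1 (habs.trans htri)).1]
  · linarith [(abs_le.1 (habs.trans htri)).2]

/-- **The arithmetic of the obstruction.**  At scale `√61`, a pattern pair at distance `s` with `s² = 2` cannot be fitted with tolerance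
`r < √61/20` per point onto two points at distance `√m` with `m ≤ 100` or `144 ≤ m`. [folklore] -/
theorem twisted_dozen_no_sqrt_two {D s r : ℝ} {m : ℤ} (hD : D = Real.sqrt (m : ℝ)) (hm : m ≤ 100 ∨ 144 ≤ m)
    (hs : s ^ 2 = 2) (hs0 : 0 ≤ s) (hr : r < Real.sqrt 61 / 20)
    (hlo : Real.sqrt 61 * s - 2 * r ≤ D) (hhi : D ≤ Real.sqrt 61 * s + 2 * r) : False := by
  have h61lt : Real.sqrt 61 < 8 := by
    rw [show (8 : ℝ) = Real.sqrt (8 ^ 2) by rw [Real.sqrt_sq (by norm_num)]]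
    exact Real.sqrt_lt_sqrt (by norm_num) (by norm_num)
  have h61gt : 7 < Real.sqrt 61 := by
    rw [show (7 : ℝ) = Real.sqrt (7 ^ 2) by rw [Real.sqrt_sq (by norm_num)]]
    exact Real.sqrt_lt_sqrt (by norm_num) (by norm_num)
  have h61sq : Real.sqrt 61 ^ 2 = 61 := Real.sq_sqrt (by norm_num)
  -- `S := √61·s` has `S² = 122`, so `11 < S < 111/10`
  have hS2 : (Real.sqrt 61 * s) ^ 2 = 122 := by rw [mul_pow, h61sq, hs]; norm_num
  have hS0 : 0 ≤ Real.sqrt 61 * s := mul_nonneg (Real.sqrt_nonneg _) hs0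
  have hSlo : 11 < Real.sqrt 61 * s := by nlinarith [hS2, hS0]
  have hShi : Real.sqrt 61 * s < 111 / 10 := by nlinarith [hS2, hS0]
  rcases hm with hm | hm
  · have hD10 : D ≤ 10 := by
      rw [hD, show (10 : ℝ) = Real.sqrt (10 ^ 2) by rw [Real.sqrt_sq (by norm_num)]]
      exact Real.sqrt_le_sqrt (by exact_mod_cast (show m ≤ 10 ^ 2 by linarith))
    linarith
  · have hD12 : 12 ≤ D := by
      rw [hD]
      exact Real.le_sqrt_of_sq_le (by exact_mod_cast (show (12 : ℤ) ^ 2 ≤ m by linarith))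
    linarith

/-- **`KR_shape12` is false** (the statement `h12` of `FrustratedLawDichotomyKissingRigidityShapeTwelve.krShape_of_krShape12`, verbatim,
negated): the twisted dozen `(0,±5,±6), (±6,0,±5), (±5,±6,0)` at scale `√61` with its `24` contacts of squared length `62` satisfies every
hypothesis and admits no `η < 1/20` fit to the fcc or the hcp kissing pattern. [folklore] -/
theorem not_krShape12 :
    ¬ (∀ (p : EuclideanSpace ℝ (Fin 3)) (d : ℝ) (q : Fin 12 → EuclideanSpace ℝ (Fin 3)) (E : Fin 12 → Fin 12 → Prop), 0 < d → (∀ a b : Fin 12, E a b → E b a) → (∀ a : Fin 12, ¬ E a a) → (∀ a : Fin 12, d ≤ dist (q a) p ∧ dist (q a) p ≤ 101 / 100 * d) → (∀ a b : Fin 12, a ≠ b → 100 / 101 * d ≤ dist (q a) (q b)) → (∀ a b : Fin 12, E a b → dist (q a) (q b) ≤ 10201 / 10000 * d) → (∀ a b : Fin 12, a ≠ b → ¬ E a b → d < dist (q a) (q b)) → (∀ a : Fin 12, Nat.card {b : Fin 12 // E a b} = 4) → ∃ (η : ℝ) (A : EuclideanSpace ℝ (Fin 3) →ₗᵢ[ℝ]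 EuclideanSpace ℝ (Fin 3)), η < 1 / 20 ∧ ((∃ e : ↥Literature.Geometry.DiscreteGeometry.fccKissingPattern ≃ Fin 12, ∀ u : ↥Literature.Geometry.DiscreteGeometry.fccKissingPattern, ‖(q (e u) - p) - d • A (u : EuclideanSpace ℝ (Fin 3))‖ ≤ η * d) ∨ (∃ e : ↥Literature.Geometry.DiscreteGeometry.hcpKissingPattern ≃ Fin 12, ∀ u : ↥Literature.Geometry.DiscreteGeometry.hcpKissingPattern, ‖(q (e u) - p) - d • A (u : EuclideanSpace ℝ (Fin 3))‖ ≤ η * d))) := by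
  intro h
  -- the integer table of the twisted dozen and its five `decide` facts
  have F1 : ∀ a : Fin 12, sqNormInt ((![![0, 5, 6], ![0, 5, -6], ![0, -5, 6], ![0, -5, -6], ![6, 0, 5], ![6, 0, -5], ![-6, 0, 5], ![-6, 0, -5], ![5, 6, 0], ![5, -6, 0], ![-5, 6, 0], ![-5, -6, 0]] : Fin 12 → Fin 3 → ℤ) a) = 61 := by
    decide
  have F2 : ∀ a b : Fin 12, a ≠ b → 62 ≤ sqNormInt ((![![0, 5, 6], ![0, 5, -6], ![0, -5, 6], ![0, -5, -6], ![6, 0, 5], ![6, 0, -5], ![-6, 0, 5], ![-6, 0, -5], ![5, 6, 0], ![5, -6, 0], ![-5, 6, 0], ![-5, -6, 0]] : Fin 12 → Fin 3 → ℤ) a - (![![0, 5, 6], ![0, 5, -6], ![0, -5, 6], ![0, -5, -6], ![6, 0, 5], ![6, 0, -5], ![-6, 0, 5], ![-6, 0, -5], ![5, 6, 0], ![5, -6, 0], ![-5, 6, 0], ![-5, -6, 0]] : Fin 12 → Fin 3 → ℤ) b) := by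
    decide
  have F3 : ∀ a b : Fin 12, sqNormInt ((![![0, 5, 6], ![0, 5, -6], ![0, -5, 6], ![0, -5, -6], ![6, 0, 5], ![6, 0, -5], ![-6, 0, 5], ![-6, 0, -5], ![5, 6, 0], ![5, -6, 0], ![-5, 6, 0], ![-5, -6, 0]] : Fin 12 → Fin 3 → ℤ) a - (![![0, 5, 6], ![0, 5, -6], ![0, -5, 6], ![0, -5, -6], ![6, 0, 5], ![6, 0, -5], ![-6, 0, 5], ![-6, 0, -5], ![5, 6, 0], ![5, -6, 0], ![-5, 6, 0], ![-5, -6, 0]] : Fin 12 → Fin 3 → ℤ) b) = sqNormInt ((![![0, 5, 6], ![0, 5, -6], ![0, -5, 6], ![0, -5, -6], ![6, 0, 5], ![6, 0, -5], ![-6, 0, 5], ![-6, 0, -5], ![5, 6, 0], ![5, -6, 0], ![-5, 6, 0], ![-5, -6, 0]] : Fin 12 → Fin 3 → ℤ) b - (![![0, 5, 6], ![0, 5, -6], ![0, -5, 6], ![0, -5, -6], ![6, 0, 5], ![6, 0, -5], ![-6, 0, 5], ![-6, 0, -5], ![5, 6, 0], ![5, -6, 0], ![-5, 6, 0], ![-5,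 -6, 0]] : Fin 12 → Fin 3 → ℤ) a) := by
    decide
  have F4 : ∀ a b : Fin 12, a ≠ b → sqNormInt ((![![0, 5, 6], ![0, 5, -6], ![0, -5, 6], ![0, -5, -6], ![6, 0, 5], ![6, 0, -5], ![-6, 0, 5], ![-6, 0, -5], ![5, 6, 0], ![5, -6, 0], ![-5, 6, 0], ![-5, -6, 0]] : Fin 12 → Fin 3 → ℤ) a - (![![0, 5, 6], ![0, 5, -6], ![0, -5, 6], ![0, -5, -6], ![6, 0, 5], ![6, 0, -5], ![-6, 0, 5], ![-6, 0, -5], ![5, 6, 0], ![5, -6, 0], ![-5, 6, 0], ![-5, -6, 0]] : Fin 12 → Fin 3 → ℤ) b) ≠ 62 → 100 ≤ sqNormInt ((![![0, 5, 6], ![0, 5, -6], ![0, -5, 6], ![0, -5, -6], ![6, 0, 5], ![6, 0, -5], ![-6, 0, 5], ![-6, 0, -5], ![5, 6, 0], ![5, -6, 0], ![-5, 6, 0], ![-5, -6, 0]] : Fin 12 → Fin 3 → ℤ) a - (![![0, 5, 6], ![0, 5, -6], ![0, -5, 6], ![0, -5, -6], ![6, 0, 5], ![6, 0, -5], ![-6,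 0, 5], ![-6, 0, -5], ![5, 6, 0], ![5, -6, 0], ![-5, 6, 0], ![-5, -6, 0]] : Fin 12 → Fin 3 → ℤ) b) := by
    decide
  have F5 : ∀ a : Fin 12, (Finset.univ.filter fun b : Fin 12 => sqNormInt ((![![0, 5, 6], ![0, 5, -6], ![0, -5, 6], ![0, -5, -6], ![6, 0, 5], ![6, 0, -5], ![-6, 0, 5], ![-6, 0, -5], ![5, 6, 0], ![5, -6, 0], ![-5, 6, 0], ![-5, -6, 0]] : Fin 12 → Fin 3 → ℤ) a - (![![0, 5, 6], ![0, 5, -6], ![0, -5, 6], ![0, -5, -6], ![6, 0, 5], ![6, 0, -5], ![-6, 0, 5], ![-6, 0, -5], ![5, 6, 0], ![5, -6, 0], ![-5, 6, 0], ![-5, -6, 0]] : Fin 12 → Fin 3 → ℤ) b) = 62).card = 4 := by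
    decide
  have F6 : ∀ a b : Fin 12, a ≠ b → sqNormInt ((![![0, 5, 6], ![0, 5, -6], ![0, -5, 6], ![0, -5, -6], ![6, 0, 5], ![6, 0, -5], ![-6, 0, 5], ![-6, 0, -5], ![5, 6, 0], ![5, -6, 0], ![-5, 6, 0], ![-5, -6, 0]] : Fin 12 → Fin 3 → ℤ) a - (![![0, 5, 6], ![0, 5, -6], ![0, -5, 6], ![0, -5, -6], ![6, 0, 5], ![6, 0, -5], ![-6, 0, 5], ![-6, 0, -5], ![5, 6, 0], ![5, -6, 0], ![-5, 6, 0], ![-5, -6, 0]] : Fin 12 → Fin 3 → ℤ) b) ≤ 100 ∨ 144 ≤ sqNormInt ((![![0, 5, 6], ![0, 5, -6], ![0, -5, 6], ![0, -5, -6], ![6, 0, 5], ![6, 0, -5], ![-6, 0, 5], ![-6, 0, -5], ![5, 6, 0], ![5, -6, 0], ![-5, 6, 0], ![-5, -6, 0]] : Fin 12 → Fin 3 → ℤ) a - (![![0, 5, 6], ![0, 5, -6], ![0, -5, 6], ![0, -5, -6], ![6, 0, 5], ![6, 0, -5], ![-6, 0, 5], ![-6, 0, -5], ![5, 6, 0],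 ![5, -6, 0], ![-5, 6, 0], ![-5, -6, 0]] : Fin 12 → Fin 3 → ℤ) b) := by
    decide
  -- the dozen in `ℝ³`
  set T : Fin 12 → Fin 3 → ℤ := ![![0, 5, 6], ![0, 5, -6], ![0, -5, 6], ![0, -5, -6], ![6, 0, 5], ![6, 0, -5], ![-6, 0, 5], ![-6, 0, -5], ![5, 6, 0], ![5, -6, 0], ![-5, 6, 0], ![-5, -6, 0]] with hT
  set q : Fin 12 → EuclideanSpace ℝ (Fin 3) := fun a => intVec (T a) with hq
  set d : ℝ := Real.sqrt 61 with hd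
  have hd0 : 0 < d := by rw [hd]; positivity
  have hdist : ∀ a b : Fin 12, dist (q a) (q b) = Real.sqrt (sqNormInt (T a - T b) : ℝ) := by
    intro a b; rw [dist_eq_norm, hq]; simp only; rw [intVec_sub, norm_intVec]
  have hnorm : ∀ a : Fin 12, dist (q a) 0 = d := by
    intro a; rw [dist_zero_right, hq]; simp only; rw [norm_intVec, F1 a]; push_cast; rfl
  have hd61 : d ^ 2 = 61 := by rw [hd]; exact Real.sq_sqrt (by norm_num)
  -- feed the witness to `KR_shape12`
  obtain ⟨η, A, hη, hfit⟩ := h 0 d q (fun a b => sqNormInt (T a - T b) = 62) hd0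
    (fun a b hab => by rw [F3 b a]; exact hab)
    (fun a haa => by simp [sub_self, sqNormInt] at haa)
    (fun a => ⟨(hnorm a).symm.le, by rw [hnorm a]; linarith⟩)
    (fun a b hab => by
      rw [hdist]
      have h62 : Real.sqrt 61 ≤ Real.sqrt (sqNormInt (T a - T b) : ℝ) :=
        Real.sqrt_le_sqrt (by exact_mod_cast (show (61 : ℤ) ≤ _ by linarith [F2 a b hab]))
      have : 100 / 101 * d ≤ d := by linarith
      exact this.trans (hd ▸ h62))
    (fun a b hab => by
      rw [hdist, show (sqNormInt (T a - T b) : ℝ) = 62 by exact_mod_cast hab, hd]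
      rw [show (10201 : ℝ) / 10000 * Real.sqrt 61 = Real.sqrt ((10201 / 10000) ^ 2 * 61) by
        rw [Real.sqrt_mul (by positivity), Real.sqrt_sq (by positivity)]]
      exact Real.sqrt_le_sqrt (by norm_num))
    (fun a b hab hE => by
      rw [hdist, hd]
      exact Real.sqrt_lt_sqrt (by norm_num) (by exact_mod_cast (show (61 : ℤ) < _ by linarith [F4 a b hab hE])))
    (fun a => by rw [Nat.card_eq_fintype_card, Fintype.card_subtype]; exact F5 a)
  have hr : η * Real.sqrt 61 < Real.sqrt 61 / 20 := by
    have h61 : (0 : ℝ) < Real.sqrt 61 := by positivity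
    nlinarith
  -- a generic `√2`-pair of a scaled integer pattern kills the fit
  have key : ∀ (S : Finset (Fin 3 → ℤ)) (N : ℕ) (hN : N ≠ 0) (v w : Fin 3 → ℤ) (hv : v ∈ S) (hw : w ∈ S) (hvw : v ≠ w)
      (hsq : (sqNormInt (v - w) : ℝ) = 2 * N) (e : ↥(scaledPattern S N) ≃ Fin 12),
      (∀ u : ↥(scaledPattern S N), ‖(q (e u) - 0) - d • A (u : EuclideanSpace ℝ (Fin 3))‖ ≤ η * d) → False := by
    intro S N hN v w hv hw hvw hsq e he
    have hmv : (Real.sqrt N)⁻¹ • intVec v ∈ scaledPattern S N := Finset.mem_image_of_mem _ hv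
    have hmw : (Real.sqrt N)⁻¹ • intVec w ∈ scaledPattern S N := Finset.mem_image_of_mem _ hw
    set u0 : ↥(scaledPattern S N) := ⟨_, hmv⟩ with hu0
    set v0 : ↥(scaledPattern S N) := ⟨_, hmw⟩ with hv0
    have hne : u0 ≠ v0 := by
      intro huv
      have := congrArg (fun z : ↥(scaledPattern S N) => (z : EuclideanSpace ℝ (Fin 3))) huv
      exact hvw (scaledPattern_map_injective hN this)
    have hab : e u0 ≠ e v0 := fun h' => hne (e.injective h')
    -- the pattern pair is at distance `s` with `s² = 2`
    have hNpos : (0 : ℝ) < Real.sqrt N := by positivity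
    have hs : ‖(u0 : EuclideanSpace ℝ (Fin 3)) - (v0 : EuclideanSpace ℝ (Fin 3))‖ ^ 2 = 2 := by
      simp only [hu0, hv0]
      rw [← smul_sub, intVec_sub, norm_smul, norm_inv, Real.norm_of_nonneg hNpos.le, norm_intVec, mul_pow, inv_pow,
        Real.sq_sqrt (by positivity), Real.sq_sqrt (by linarith [show (0 : ℝ) ≤ 2 * N by positivity]), hsq]
      field_simp
    obtain ⟨hlo, hhi⟩ := fit_pair_bound hd0.le A (by simpa using he u0) (by simpa using he v0)
    have hD : ‖q (e u0) - q (e v0)‖ = Real.sqrt (sqNormInt (T (e u0) - T (e v0)) : ℝ) := by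
      rw [← dist_eq_norm, hdist]
    rw [hD, hd] at hlo hhi
    exact twisted_dozen_no_sqrt_two rfl (F6 _ _ hab) hs (norm_nonneg _) hr hlo hhi
  rcases hfit with ⟨e, he⟩ | ⟨e, he⟩
  · have h4 : sqNormInt ((![1, 1, 0] : Fin 3 → ℤ) - ![-1, 1, 0]) = 4 := by decide
    exact key fccInt 2 two_ne_zero ![1, 1, 0] ![-1, 1, 0] (by decide) (by decide) (by decide)
      (by rw [h4]; norm_num) e he
  · have h36 : sqNormInt ((![3, 3, 0] : Fin 3 → ℤ) - ![-3, 3, 0]) = 36 := by decide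
    exact key hcpInt 18 (by norm_num) ![3, 3, 0] ![-3, 3, 0] (by decide) (by decide) (by decide)
      (by rw [h36]; norm_num) e he

end Summit.AtomisticToContinuum.Crystallization.Theorems.FrustratedLawDichotomyTwistedDozen

end
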